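import Summits.RiemannHypothesis.RiemannHypothesis.Theorems.SpectralTraceWindowTraceArchStubCarrierTrace
import HarnessLib

/-!
# The configuration trace formula in phase form (`stub_excisedTrace`)

Stub `stub_excisedTrace` of the line `causal-level-sets` for the crux `WindowTraceArch`
(stmt-RiemannHypothesis-11195; skeleton
`Summit.RiemannHypothesis.RiemannHypothesis.Cruxes.WindowTraceArch.CausalLevelSets`).

**Statement.** Let `γ, b : ℕ → ℝ` be a configuration of smeared atoms with widths
`δ ≤ b_k ≤ B` (`δ > 0`) and `Σ_k 1/(1 + γ_k²) < ∞`, let `L` with `log 2 < 2L` (tilt) and `β ∈ ℝ`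
(anchor). Write `ĝ(s) = weilMellin g s` and `P_k(x) = b_k/((x − γ_k)² + b_k²)` (Poisson kernels).
Then for every Weil test `g` (`IsWeilTest`) with `tsupport g ⊆ [−log 2, log 2]`, the family
`ĝ(1/2 + it)` indexed by the real PHASE LEVEL SET `{t : ∃ n ∈ ℤ, L t + ∫₀ᵗ Σ_k P_k(x) dx = β + nπ}`
is summable (`HasSum`, unconditionally) with sum `2L g(0) + Σ_k ∫ g(x) e^{iγ_k x − b_k|x|} dx`.

**Proof** (the `G`-half of the composition of the line). Let `E_G` be the structure function of
the configuration (`stub_structureFunction`: Hermite–Biehler, zero-free with polynomially bounded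
`E_G'/E_G` on `Im z ≥ −δ/2`, `E_G(t) = |E_G(t)| e^{−iφ_G(t)}`, `−Im E_G'/E_G = Σ_k P_k` on `ℝ` and
`φ_G(v) − φ_G(u) = ∫ᵤᵛ Σ_k P_k`). With `β' = β + φ_G(0)`, level-set membership
`Im (e^{i(β' − Lt)} E_G(t)) = 0` is phase integrality `L t + φ_G(t) ∈ β' + πℤ`
(`carrierTrace_im_tilt_eq_zero_iff`), i.e. `L t + ∫₀ᵗ Σ_k P_k ∈ β + πℤ`. The causal crystallisation
`stub_causalCrystallisation` (tilt `L > (log 2)/2`) sums `ĝ(1/2 + it)` over this level set to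
`(1/π) ∫ ĝ(1/2 + it)(L − Im E_G'/E_G(t)) dt = (1/π) ∫ ĝ (L + Σ_k P_k)`, which equals
`2L g(0) + Σ_k ∫ g e^{iγ_k x − b_k|x|}` by `stub_smearedWindowFormula`; finally the sum is transported
along the equivalence of the two index subtypes (`Equiv.subtypeEquivRight`).

**Sources.** L. de Branges, *Hilbert Spaces of Entire Functions* (1968), §§19–22 (phase functions
and level sets of Hermite–Biehler functions). All ingredients are proved tree / Mathlib facts (the
sibling stubs of this line).
-/

set_option linter.dupNamespace false

noncomputable section

open Complex Set MeasureTheory Filter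
open scoped Real Topology

namespace Summit.RiemannHypothesis.RiemannHypothesis.Theorems.SpectralTraceWindowTraceArch

open Literature.NumberTheory.LFunctions
open Literature.Analysis.DeBrangesSpaces (IsHermiteBiehler sharp)

/-- **stub_excisedTrace — the configuration trace formula in phase form.** For a smeared
configuration `G = (γ, b)` (widths in `[δ, B]`, `δ > 0`, `Σ 1/(1+γ²) < ∞`), `log 2 < 2L`, `β ∈ ℝ`: the
real set `{t : ∃ n : ℤ, L t + ∫₀ᵗ Σ_k b_k/((x−γ_k)²+b_k²) dx = β + nπ}` (the level set
`Im (e^{i(β'−Lt)} E_G(t)) = 0`, `β' = β + φ_G(0)`, of the tilted structure function `e^{−iLz} E_G`) sums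
`ĝ(1/2+it)` (`HasSum`) to `2L g(0) + Σ_k ∫ g(x) e^{iγ_k x − b_k|x|} dx` for every Weil test `g` supported
in `[−log 2, log 2]` (stubs `structureFunction`, `causalCrystallisation`, `smearedWindowFormula`). -/
theorem stub_excisedTrace :
    ∀ (γ b : ℕ → ℝ) (δ B L β : ℝ), 0 < δ → (∀ k, δ ≤ b k ∧ b k ≤ B) →
      Summable (fun k => 1 / (1 + (γ k) ^ 2)) → Real.log 2 < 2 * L →
      ∀ g : ℝ → ℂ, IsWeilTest g → tsupport g ⊆ Icc (-Real.log 2) (Real.log 2) →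
        HasSum
          (fun l : {t : ℝ // ∃ n : ℤ, L * t
              + (∫ x in (0 : ℝ)..t, ∑' k, b k / ((x - γ k) ^ 2 + (b k) ^ 2)) = β + n * π} =>
            weilMellin g (1 / 2 + ((l : ℝ) : ℂ) * I))
          (2 * L * g 0
            + ∑' k, ∫ x : ℝ, g x * cexp (((γ k * x : ℝ) : ℂ) * I) * ((Real.exp (-(b k * |x|)) : ℝ) : ℂ)) := by
  intro γ b δ B L β hδ hb hγ hL g hg hgs
  classical
  obtain ⟨EG, φG, CG, NG, hEG, hzG, hgG, hpolG, hdensG, hphG⟩ :=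
    stub_structureFunction γ b δ B hδ hb hγ
  -- the level-set predicate in phase form, anchor `β' = β + φ_G(0)`
  set β' : ℝ := β + φG 0 with hβ'
  have hPG : ∀ t : ℝ, (cexp (((β' - L * t : ℝ) : ℂ) * I) * EG t).im = 0 ↔ ∃ n : ℤ,
      L * t + (∫ x in (0 : ℝ)..t, ∑' k, b k / ((x - γ k) ^ 2 + (b k) ^ 2)) = β + n * π := by
    intro t
    rw [carrierTrace_im_tilt_eq_zero_iff (hpolG t) (hzG t (by simp; linarith)), ← hphG 0 t, hβ']
    constructor <;> rintro ⟨n, hn⟩ <;> exact ⟨n, by linarith⟩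
  -- causal crystallisation for `E_G` on the strip `Im z ≥ -δ/2`
  have hclsG := stub_causalCrystallisation EG L (δ / 2) CG NG hEG (half_pos hδ) hzG hgG β' (Real.log 2)
    hL g hg hgs
  -- rewrite the density `L - Im E_G'/E_G = L + Σ_k P_k`
  have hintG : (fun t : ℝ => weilMellin g (1 / 2 + (t : ℂ) * I) *
      (((L - (deriv EG t / EG t).im : ℝ)) : ℂ)) =
      fun t : ℝ => weilMellin g (1 / 2 + (t : ℂ) * I) *
        (((L + ∑' k, b k / ((t - γ k) ^ 2 + (b k) ^ 2) : ℝ)) : ℂ) := by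
    funext t; rw [sub_eq_add_neg, hdensG t]
  rw [hintG] at hclsG
  -- evaluate the integral by the smeared window formula
  have h2G := stub_smearedWindowFormula γ b δ B L hδ hb hγ g hg
  set TG : ℂ := ∑' k, ∫ x : ℝ, g x * cexp (((γ k * x : ℝ) : ℂ) * I) *
    ((Real.exp (-(b k * |x|)) : ℝ) : ℂ) with hTG
  have hVG : (1 / (π : ℂ)) * (∫ t : ℝ, weilMellin g (1 / 2 + (t : ℂ) * I) *
      (((L + ∑' k, b k / ((t - γ k) ^ 2 + (b k) ^ 2) : ℝ)) : ℂ)) = 2 * L * g 0 + TG := by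
    rw [hTG, h2G.tsum_eq]; ring
  rw [hVG] at hclsG
  -- transport along the equivalence of the two index subtypes
  exact (Equiv.hasSum_iff (Equiv.subtypeEquivRight hPG)).1 hclsG

/-- **Curried form of `stub_excisedTrace`** (convenience corollary, same content). -/
theorem excisedTrace {γ b : ℕ → ℝ} {δ B L β : ℝ} (hδ : 0 < δ) (hb : ∀ k, δ ≤ b k ∧ b k ≤ B)
    (hγ : Summable (fun k => 1 / (1 + (γ k) ^ 2))) (hL : Real.log 2 < 2 * L) {g : ℝ → ℂ}
    (hg : IsWeilTest g) (hgs : tsupport g ⊆ Icc (-Real.log 2) (Real.log 2)) :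
    HasSum
      (fun l : {t : ℝ // ∃ n : ℤ, L * t
          + (∫ x in (0 : ℝ)..t, ∑' k, b k / ((x - γ k) ^ 2 + (b k) ^ 2)) = β + n * π} =>
        weilMellin g (1 / 2 + ((l : ℝ) : ℂ) * I))
      (2 * L * g 0
        + ∑' k, ∫ x : ℝ, g x * cexp (((γ k * x : ℝ) : ℂ) * I) * ((Real.exp (-(b k * |x|)) : ℝ) : ℂ)) :=
  stub_excisedTrace γ b δ B L β hδ hb hγ hL g hg hgs

end Summit.RiemannHypothesis.RiemannHypothesis.Theorems.SpectralTraceWindowTraceArch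

end
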